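import Summits.Ventures.PercRepro.RankLevelSetBiIndepPerElem

/-! # RankLevelSetBiIndepIncl — THE INCLUSION-MATCHING FORM (IM) OF THE PER-ELEMENT INEQUALITY, THE DISJOINT-MATCHING
FORM (PM′) BETWEEN CONSECUTIVE BI-INDEPENDENT LEVELS, AND THE BRIDGE (IM) ⟹ (★★) (night-1 g24; dossier §36.3)

For a finite matroid `M` on `E` (`#E = n`), an element `y` and a level `j` with `2j + 1 < n`, write
`W_j := {Z bi-independent, #Z = j, y ∉ Z, Z ∪ {y} dependent}` (`absorbing M y j`: the members avoiding `y` that ABSORB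
`y`) and `D^{¬y}_r := {V bi-independent, #V = r, y ∉ V}` (`biIndepOmit M y r`).

* `BiIndepIncl M` (a `Prop`, NOT asserted) — (IM): an INJECTION BY INCLUSION `W_j ↪ D^{¬y}_{n−1−j}` (`Z ⊆ f Z`).
  Census (night-1 g24, exact Hall by max-flow): every matroid on ≤ 8 elements (1,285 `(M, y, j)` instances at `n = 8`),
  every 10th matroid on 9 elements (241 instances), 0 failures; the weaker shadow inequality `#∇W_j ≥ #W_j` on all
  2,602 instances of the 9-element catalogue, 0 failures.
* `BiIndepDisjointMatching M` (a `Prop`, NOT asserted) — (PM′): an injection `D_i ↪ D_{i+1}` with DISJOINT images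
  (`V ∩ f V = ∅`), for `2i + 1 < n` — equivalently (complement the image) an injection by inclusion `D_i ↪ D_{n−1−i}`;
  (PM′) is the parallel-element case of (IM). Census: every matroid on ≤ 9 elements (401 instances at `n = 8`, 1,387 at
  `n = 9`), 0 failures. The COMPLEMENTARY matching `D_i ↪ D_{n−i}` is FALSE (`n = 7`, dossier §36.4 a).
* **`biIndepPerElem_of_incl`** — THE BRIDGE: `BiIndepIncl M → BiIndepPerElem M`. Proof: the members `Z ∈ D_j` avoiding
  `y` split into those with `Z ∪ {y}` independent (sent to `Z ∪ {y} ∈ D_{j+1}`, which contains `y`) and the absorbing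
  ones (sent to `E ∖ f Z ∈ D_{j+1}`, which contains `y`); the two maps are injective and their images are disjoint
  (`{y} ∪ (E ∖ Q)` is independent for the first, dependent for the second), so `#{Z ∈ D_j : y ∉ Z} ≤ #{Q ∈ D_{j+1} : y ∈ Q}`.
Hence, with `RankLevelSetBiIndepPerElem`, (IM) implies the monotone form of the profile and the global level-wise
theorems. Nothing here asserts (IM) or (PM′); every declaration has a docstring; imports: the cell's own modules and
Mathlib only. Axioms: standard. -/

namespace PercRepro

open Set Matroid

variable {α : Type} (M : Matroid α) [M.Finite]

omit [M.Finite] in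
/-- **The absorbing members**: the bi-independent `j`-sets `Z` with `y ∉ Z` and `Z ∪ {y}` DEPENDENT (`y ∈ cl Z`). -/
def absorbing (y : α) (j : ℕ) : Set (Set α) :=
  {Z ∈ biIndep M j | y ∉ Z ∧ ¬ M.Indep (insert y Z)}

omit [M.Finite] in
/-- **The bi-independent `r`-sets avoiding `y`.** -/
def biIndepOmit (y : α) (r : ℕ) : Set (Set α) :=
  {V ∈ biIndep M r | y ∉ V}

omit [M.Finite] in
/-- **(IM) — THE INCLUSION-MATCHING FORM** (a `Prop`, NOT asserted): for every `y ∈ E` and `2j + 1 < #E` there is an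
injection `f` from the absorbing members `W_j` into the bi-independent `(#E − 1 − j)`-sets avoiding `y`, with
`Z ⊆ f Z`. Every such image automatically absorbs `y` as well (`absorbing_of_superset`). -/
def BiIndepIncl : Prop :=
  ∀ y ∈ M.E, ∀ j : ℕ, 2 * j + 1 < M.E.ncard →
    ∃ f : Set α → Set α, Set.InjOn f (absorbing M y j) ∧
      ∀ Z ∈ absorbing M y j, f Z ∈ biIndepOmit M y (M.E.ncard - 1 - j) ∧ Z ⊆ f Z

omit [M.Finite] in
/-- **(PM′) — THE DISJOINT-MATCHING FORM BETWEEN CONSECUTIVE LEVELS** (a `Prop`, NOT asserted): for every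
`2i + 1 < #E` there is an injection `D_i ↪ D_{i+1}` whose images are disjoint from their arguments (equivalently, by
complementing the image, an injection by inclusion `D_i ↪ D_{#E−1−i}`). -/
def BiIndepDisjointMatching : Prop :=
  ∀ i : ℕ, 2 * i + 1 < M.E.ncard →
    ∃ f : Set α → Set α, Set.InjOn f (biIndep M i) ∧
      ∀ V ∈ biIndep M i, f V ∈ biIndep M (i + 1) ∧ Disjoint V (f V)

omit [M.Finite] in
/-- A bi-independent superset of an absorbing member avoiding `y` is absorbing: `y ∉ V'`, `V' ⊇ Z`, `Z ∪ {y}`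
dependent give `V' ∪ {y}` dependent. -/
lemma absorbing_of_superset {y : α} {j r : ℕ} {Z V' : Set α} (hZ : Z ∈ absorbing M y j)
    (hV' : V' ∈ biIndepOmit M y r) (hZV : Z ⊆ V') : V' ∈ absorbing M y r := by
  obtain ⟨-, -, hdep⟩ := hZ
  obtain ⟨hV'bi, hyV'⟩ := hV'
  exact ⟨hV'bi, hyV', fun hind => hdep (hind.subset (Set.insert_subset_insert hZV))⟩

omit [M.Finite] in
/-- `{y} ∪ (E ∖ (Z ∪ {y})) = E ∖ Z` for `y ∈ E`, `y ∉ Z`. -/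
lemma insert_diff_insert_eq {y : α} {Z : Set α} (hy : y ∈ M.E) (hyZ : y ∉ Z) :
    insert y (M.E \ insert y Z) = M.E \ Z := by
  ext x
  simp only [Set.mem_insert_iff, Set.mem_sdiff, not_or]
  constructor
  · rintro (rfl | ⟨hxE, -, hxZ⟩)
    · exact ⟨hy, hyZ⟩
    · exact ⟨hxE, hxZ⟩
  · rintro ⟨hxE, hxZ⟩
    by_cases hxy : x = y
    · exact Or.inl hxy
    · exact Or.inr ⟨hxE, hxy, hxZ⟩

/-- **THE BRIDGE (IM) ⟹ (★★)**: `BiIndepIncl M → BiIndepPerElem M`. -/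
theorem biIndepPerElem_of_incl (h : BiIndepIncl M) : BiIndepPerElem M := by
  intro y hy j hj
  obtain ⟨f, hfinj, hf⟩ := h y hy j hj
  classical
  have hEfin : M.E.Finite := M.ground_finite
  have hn1 : M.E.ncard - (M.E.ncard - 1 - j) = j + 1 := by omega
  let g : Set α → Set α := fun Z => if M.Indep (insert y Z) then insert y Z else M.E \ f Z
  have hmaps : ∀ Z ∈ {Z ∈ biIndep M j | y ∉ Z}, g Z ∈ {Q ∈ biIndep M (j + 1) | y ∈ Q} := by
    intro Z hZ
    obtain ⟨⟨hZE, hZcard, hZind, hZcind⟩, hyZ⟩ := hZ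
    by_cases hind : M.Indep (insert y Z)
    · have hg : g Z = insert y Z := if_pos hind
      rw [hg]
      refine ⟨⟨Set.insert_subset hy hZE, ?_, hind, ?_⟩, Set.mem_insert y Z⟩
      · rw [Set.ncard_insert_of_notMem hyZ (hEfin.subset hZE), hZcard]
      · exact hZcind.subset (Set.sdiff_subset_sdiff_right (Set.subset_insert y Z))
    · have hg : g Z = M.E \ f Z := if_neg hind
      rw [hg]
      have hZabs : Z ∈ absorbing M y j := ⟨⟨hZE, hZcard, hZind, hZcind⟩, hyZ, hind⟩
      obtain ⟨⟨hfbi, hyf⟩, -⟩ := hf Z hZabs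
      have hc := mem_biIndep_compl M hfbi
      rw [hn1] at hc
      exact ⟨hc, ⟨hy, hyf⟩⟩
  have hinj : Set.InjOn g {Z ∈ biIndep M j | y ∉ Z} := by
    intro Z hZ Z' hZ' hgg
    obtain ⟨⟨hZE, hZcard, hZind, hZcind⟩, hyZ⟩ := hZ
    obtain ⟨⟨hZ'E, hZ'card, hZ'ind, hZ'cind⟩, hyZ'⟩ := hZ'
    by_cases hind : M.Indep (insert y Z) <;> by_cases hind' : M.Indep (insert y Z')
    · -- both non-absorbing: `insert y Z = insert y Z'` with `y ∉ Z, Z'`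
      have hg : g Z = insert y Z := if_pos hind
      have hg' : g Z' = insert y Z' := if_pos hind'
      rw [hg, hg'] at hgg
      ext x
      constructor
      · intro hx
        have h1 : x ∈ insert y Z' := by rw [← hgg]; exact Set.mem_insert_of_mem y hx
        rcases Set.mem_insert_iff.mp h1 with hxy | hx'
        · exact absurd (hxy ▸ hx) hyZ
        · exact hx'
      · intro hx
        have h1 : x ∈ insert y Z := by rw [hgg]; exact Set.mem_insert_of_mem y hx
        rcases Set.mem_insert_iff.mp h1 with hxy | hx'
        · exact absurd (hxy ▸ hx) hyZ'
        · exact hx'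
    · -- `Z` non-absorbing, `Z'` absorbing: the images differ (`{y} ∪ (E ∖ Q)` independent vs dependent)
      exfalso
      have hg : g Z = insert y Z := if_pos hind
      have hg' : g Z' = M.E \ f Z' := if_neg hind'
      rw [hg, hg'] at hgg
      have hZ'abs : Z' ∈ absorbing M y j := ⟨⟨hZ'E, hZ'card, hZ'ind, hZ'cind⟩, hyZ', hind'⟩
      obtain ⟨⟨hfbi, -⟩, hZ'f⟩ := hf Z' hZ'abs
      have hfE : f Z' ⊆ M.E := hfbi.1
      have hfeq : f Z' = M.E \ insert y Z := by
        rw [hgg, Set.sdiff_sdiff_cancel_left hfE]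
      have hindep : M.Indep (insert y (f Z')) := by
        rw [hfeq, insert_diff_insert_eq M hy hyZ]; exact hZcind
      exact hind' (hindep.subset (Set.insert_subset_insert hZ'f))
    · -- the symmetric case
      exfalso
      have hg : g Z = M.E \ f Z := if_neg hind
      have hg' : g Z' = insert y Z' := if_pos hind'
      rw [hg, hg'] at hgg
      have hZabs : Z ∈ absorbing M y j := ⟨⟨hZE, hZcard, hZind, hZcind⟩, hyZ, hind⟩
      obtain ⟨⟨hfbi, -⟩, hZf⟩ := hf Z hZabs
      have hfE : f Z ⊆ M.E := hfbi.1
      have hfeq : f Z = M.E \ insert y Z' := by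
        rw [← hgg, Set.sdiff_sdiff_cancel_left hfE]
      have hindep : M.Indep (insert y (f Z)) := by
        rw [hfeq, insert_diff_insert_eq M hy hyZ']; exact hZ'cind
      exact hind (hindep.subset (Set.insert_subset_insert hZf))
    · -- both absorbing: `E ∖ f Z = E ∖ f Z'` gives `f Z = f Z'`, then injectivity of `f`
      have hg : g Z = M.E \ f Z := if_neg hind
      have hg' : g Z' = M.E \ f Z' := if_neg hind'
      rw [hg, hg'] at hgg
      have hZabs : Z ∈ absorbing M y j := ⟨⟨hZE, hZcard, hZind, hZcind⟩, hyZ, hind⟩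
      have hZ'abs : Z' ∈ absorbing M y j := ⟨⟨hZ'E, hZ'card, hZ'ind, hZ'cind⟩, hyZ', hind'⟩
      have hfE : f Z ⊆ M.E := (hf Z hZabs).1.1.1
      have hfE' : f Z' ⊆ M.E := (hf Z' hZ'abs).1.1.1
      have hff : f Z = f Z' := by
        have h1 : M.E \ (M.E \ f Z) = M.E \ (M.E \ f Z') := by rw [hgg]
        rwa [Set.sdiff_sdiff_cancel_left hfE, Set.sdiff_sdiff_cancel_left hfE'] at h1
      exact hfinj hZabs hZ'abs hff
  exact Set.ncard_le_ncard_of_injOn g hmaps hinj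
    ((biIndep_finite M (j + 1)).subset (fun Q hQ => hQ.1))

/-- **(IM) gives the monotone form of the profile** and hence (with `RankLevelSetBiIndepPerElem`) the global
level-wise theorems: `BiIndepIncl M → BiIndepMono M`. -/
theorem biIndepMono_of_incl (h : BiIndepIncl M) : BiIndepMono M :=
  biIndepMono_of_perElem M (biIndepPerElem_of_incl M h)

end PercRepro
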